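import Literature.MathematicalPhysics.QuantumFieldTheory.Balaban1983to89.B15Prop1RealChartFamilyExplicit
import Literature.MathematicalPhysics.QuantumFieldTheory.Balaban1983to89.B15DeterminingSetsB

/-!
# `Balaban1983to89.B15Prop1RealChartFamilyExplicitB` — [Balaban1985Variational] (15) p. 280, Prop. 9 (190) p. 309; [Balaban1988Convergent] (2.12)–(2.14) pp. 256–257; [Balaban1989LargeFieldI] Prop. 1 p. 194;
# [Balaban1989LargeFieldII] (1.12) p. 359; [Balaban1984PropagatorsII] (= [II]) (2.3) p. 224: THE EXPLICIT REAL CHART FAMILY OF A HOLOMORPHIC MINIMISER CHART **OVER A BOND-LEVEL DATUM** — the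
# print-datum edition of dag-n12-w5's `B15Prop1RealChartFamilyExplicit.realChartFamily_explicit` (the one declaration of that module with a datum-bearing statement; it is used by N12's junction of
# record v14ᴸ)

statement-level skeleton of published theorems with citation tags; proofs where landed; nothing here is a claim about
the Yang–Mills mass gap

Cell `pub-ymgap` (HUMAN RULINGS D-0062 ∕ D-0149), lane `pub-ymgap-dag-n12-c` g35 (R134 seat (a), N12 = [B15], s1, lane owner); `--kind proof --supports` K1⁹ `stmt-QuantumFields-27364`;
count-neutral.  THEOREMS ONLY (0 `def`, 0 `instance`, 0 `sorry`).  (E1) variant (iii-b), class (γ) of the lane's census-by-declaration (bus [DAGN12C-G35], 2026-08-30).  CONVENTION for (γ) twins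
whose determining set is a PURE PARAMETER of the statement (it enters only through the predicate `IsMinimizer av reg 𝐁 · ·`): namespace `…<Parent>B`, SAME theorem names, `IsMinimizer … (𝐁 : DetSet)`
↦ `IsMinimizerB … (𝔅 : BDetSet)` (F0a), proof text VERBATIM (generator `lean/g35/gen/gen_gamma.py`, block-extracted from the parent's tree bytes); the parent's datum-free lemmas are REUSED by
name (`open …<Parent>`).  The (b) statement is the instance `𝔅 := bondsDet 𝐁` (`isMinimizer_iff_isMinimizerB`, `Iff.rfl`).

HONESTY GUARD (director-ym №338 (5)).  PURELY ADDITIVE: the parent stays landed and true on its own text; nothing in it is edited; no displayed premise of any consumer is deleted or weakened.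
Nothing of [15] asserted (the holomorphic minimiser chart `hreal` is a HYPOTHESIS); count-neutral; N12 NOT discharged; K0⁷ ∕ K1⁹ NOT closed; one finite 𝕋⁴ programme at fixed ε — nothing continuum ∕
ℝ⁴ ∕ OS; the Yang–Mills mass gap (Clay) is NOT proved by any of this.

WHAT IS HERE.  ★★ `realChartFamily_explicit` (namespace `…B15Prop1RealChartFamilyExplicitB`; over `𝔅 : BDetSet P`).

References: [15] = [Balaban1985Variational] (15) p.280, Thm 1 p.279, Prop. 9 (190) p.309; [III] = [Balaban1988Convergent] (2.12)–(2.14) pp.256–257; [Balaban1989LargeFieldI] Prop. 1 p.194; [Balaban1989LargeFieldII]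
p.359, (1.12) p.359; [II] = [Balaban1984PropagatorsII] (2.3) p.224; [HormanderSCV1973] Thm 2.2.1.
-/

noncomputable section

open Set Metric Filter
open scoped Topology ContDiff Matrix.Norms.L2Operator ComplexConjugate

namespace Literature.MathematicalPhysics.QuantumFieldTheory.Balaban1983to89.B15Prop1RealChartFamilyExplicitB

open B15SU2ChartHolomorphic (genE logCoordC genE_zero_eq genE_one_eq genE_two_eq star_genE)
open B15Prop1SliceCoordinates (GaugeSlice ιA norm_ιA_apply_le)
open B15Prop1SliceTaylorCalculus (ιAc cplxSliceL cplxSliceL_apply ιAc_cplxSlice)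
open B15Prop1ChartCalculusSU2 (E3)
open T4CubeChartGnomonic (SU2)
open T4Continuum B15DeterminingSets B15DeterminingSetsB GaugeField
open T4AdjointCovarianceUnitary (lieSU)
open Node00
open B16Sect1Backgrounds (expMul expMul_zero)
open B15Prop1AnalyticExtClause (cplxVec norm_cplxVec)
open B15Prop1ChartSU2 (su2Chart)
open Literature.MathematicalPhysics.QuantumLattice (quatMatrix)
open T4HaarSU2ExpChart (imQuat norm_imQuat)
open T4QuatExpLog (norm_quatMatrix)
open B15Prop1RealChartFamilyFromMinimiserChart (contDiffOn_matrix_of_entries contDiffAt_logCoordC contDiff_reVec logCoordC_one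
  logCoordC_re_of_mem_unitaryGroup coe_mul_exp_logChart_eq exp_coe_eq_expPointC binders_of_contDiffAt_two)
open Literature.MathematicalPhysics.QuantumFieldTheory.BalabanImbrieJaffe1984to88.BIJ85Eq453GaugeField (qsstarGIter0)
open B15Prop1RealChartFamilyExplicit

variable {P : Params} {k : ℕ} [DecidableEq (PBond P k)]

/-- ★★ **(K′) EXPLICIT — THE THREE CLAUSES OF THE REAL CHART FAMILY WITH THE BASE MINIMISER AS INPUT.**  For the chart `Ũ` of (J0′) (entrywise ℂ-differentiable on
`ball 0 R`, real points = matrix fields of (2.12) minimisers) and ANY `U₀` with `Ũ(0,0) = U₀` bondwise, the explicit family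
`X_f Y (b) := φ(Re logCoordC(U₀(b)⋆ · Ũ(0, ι ιA Y)(b)))` has `X_f 0 = 0`, is `C²` at `0`, and `expChart U₀ (X_f Y)` is a (2.12) minimiser of the rotated datum for all `Y` near `0` —
the construction of `B15Prop1RealChartFamilyFromMinimiserChart.exists_realChartFamily_of_minimiserChart` (p608072) with its witness DISPLAYED, so that further letters about
the SAME family (its velocity, §3–§4) can be stated. [cite: Balaban1985Variational, (15) p.280, Prop. 9 (190) p.309; Balaban1988Convergent, (2.12)–(2.14) pp.256–257; Balaban1989LargeFieldI, Prop. 1 p.194 (last clause); Balaban1989LargeFieldII, p.359, (1.12) p.359; HormanderSCV1973, Thm 2.2.1] -/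
theorem realChartFamily_explicit (S : Set (Site P k)) (T : Finset (PBond P k))
    (φ : EuclideanSpace ℝ (Fin 3) →ₗ[ℝ] lieSU (Fin 2)) (hφ : ∀ v, ((φ v : lieSU (Fin 2)) : Matrix (Fin 2) (Fin 2) ℂ) = quatMatrix (imQuat v))
    (av : ∀ j, Averaging P j SU2) (reg : Set (GaugeField P 0 SU2)) (𝔅 : BDetSet P)
    (ext : GaugeField P k SU2 → GaugeField P k SU2) (Vk : GaugeField P k SU2) {R : ℝ} (hR : 0 < R)
    (Ũ : VecField P k (EuclideanSpace ℂ (Fin 3)) × VecField P k (EuclideanSpace ℂ (Fin 3)) → PBond P 0 → Matrix (Fin 2) (Fin 2) ℂ)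
    (hdiff : ∀ b a c, DifferentiableOn ℂ (fun z => Ũ z b a c) (ball 0 R))
    (hreal : ∀ p B' : VecField P k E3, ‖p‖ < R → ‖B'‖ < R → ∃ U' : GaugeField P 0 SU2,
      (∀ b, Ũ (cplxVec p, cplxVec B') b = ((U' b : SU2) : Matrix (Fin 2) (Fin 2) ℂ)) ∧
        IsMinimizerB av reg 𝔅 (avgFamily av (qsstarGIter0 k (expMul su2Chart B' (ext (expMul su2Chart p Vk))))) U')
    (U₀ : GaugeField P 0 SU2) (hU₀eq : ∀ b, Ũ (cplxVec (0 : VecField P k E3), cplxVec (0 : VecField P k E3)) b = ((U₀ b : SU2) : Matrix (Fin 2) (Fin 2) ℂ))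
    (Xf : GaugeSlice S T E3 → PBond P 0 → lieSU (Fin 2))
    (hXf : Xf = fun Y b => φ (WithLp.toLp 2 fun a =>
      (logCoordC (star ((U₀ b : SU2) : Matrix (Fin 2) (Fin 2) ℂ) * Ũ (cplxVec (0 : VecField P k E3), cplxVec (ιA S T Y)) b) a).re)) :
    Xf 0 = 0 ∧ ContDiffAt ℝ 2 Xf 0 ∧
      ∀ᶠ Y in 𝓝 (0 : GaugeSlice S T E3),
        IsMinimizerB av reg 𝔅 (avgFamily av (qsstarGIter0 k (expMul su2Chart (ιA S T Y) (ext Vk)))) (expChart U₀ (Xf Y)) := by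
  have h0R : ‖(0 : VecField P k E3)‖ < R := by simpa using hR
  -- the ℝ-affine parameter map of the slice into the complexified chart parameters
  set g : GaugeSlice S T E3 → VecField P k (EuclideanSpace ℂ (Fin 3)) × VecField P k (EuclideanSpace ℂ (Fin 3)) :=
    fun Y => (cplxVec (0 : VecField P k E3), cplxVec (ιA S T Y)) with hgdef
  have hg0 : g 0 = 0 := cplxVec_pair_zero S T
  have hg2 : ContDiff ℝ ((2 : ℕ) : WithTop ℕ∞) (fun Y : GaugeSlice S T E3 => cplxVec (ιA S T Y)) := by
    have h := (((ιAc S T).restrictScalars ℝ).comp (cplxSliceL S T)).contDiff (n := ((2 : ℕ) : WithTop ℕ∞))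
    have hfun : (fun Y : GaugeSlice S T E3 => cplxVec (ιA S T Y)) =
        fun Y => ((ιAc S T).restrictScalars ℝ) (cplxSliceL S T Y) := by
      funext Y
      rw [ContinuousLinearMap.coe_restrictScalars', cplxSliceL_apply, ιAc_cplxSlice]
    rw [hfun]
    exact h
  have hgC : ContDiff ℝ ((2 : ℕ) : WithTop ℕ∞) g := contDiff_const.prodMk hg2
  -- the value at the base: `U₀⋆ · Ũ(0) = 1` bondwise
  have hA0 : ∀ b, star ((U₀ b : SU2) : Matrix (Fin 2) (Fin 2) ℂ) * Ũ (g 0) b = 1 := fun b => by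
    have hg0' : g 0 = (cplxVec (0 : VecField P k E3), cplxVec (0 : VecField P k E3)) := by
      simp only [hgdef, map_zero]
    rw [hg0', hU₀eq b]
    exact Matrix.mem_unitaryGroup_iff'.1 (U₀ b).prop.1
  -- regularity, bond by bond
  have hMb : ∀ b, ContDiffAt ℝ ((2 : ℕ) : WithTop ℕ∞) (fun Y => star ((U₀ b : SU2) : Matrix (Fin 2) (Fin 2) ℂ) * Ũ (g Y) b) 0 :=
      fun b => by
    have h1 : ContDiffOn ℂ ((2 : ℕ) : WithTop ℕ∞) (fun z => Ũ z b) (ball 0 R) := contDiffOn_matrix_of_entries isOpen_ball (hdiff b) 2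
    have h2 : ContDiffAt ℂ ((2 : ℕ) : WithTop ℕ∞) (fun z => star ((U₀ b : SU2) : Matrix (Fin 2) (Fin 2) ℂ) * Ũ z b) 0 :=
      contDiffAt_const.mul (h1.contDiffAt (isOpen_ball.mem_nhds (mem_ball_self hR)))
    have h3 : ContDiffAt ℝ ((2 : ℕ) : WithTop ℕ∞) (fun z => star ((U₀ b : SU2) : Matrix (Fin 2) (Fin 2) ℂ) * Ũ z b) (g 0) := by
      rw [hg0]; exact h2.restrict_scalars ℝ
    exact h3.comp 0 hgC.contDiffAt
  have hLb : ∀ b, ContDiffAt ℝ ((2 : ℕ) : WithTop ℕ∞)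
      (fun Y => logCoordC (star ((U₀ b : SU2) : Matrix (Fin 2) (Fin 2) ℂ) * Ũ (g Y) b)) 0 := fun b => by
    have h3 : ContDiffAt ℝ ((2 : ℕ) : WithTop ℕ∞) logCoordC (star ((U₀ b : SU2) : Matrix (Fin 2) (Fin 2) ℂ) * Ũ (g 0) b) := by
      rw [hA0 b]
      exact (contDiffAt_logCoordC (A := 1) (by simp) 2).restrict_scalars ℝ
    have h4 := h3.comp 0 (hMb b)
    exact h4
  have hXb : ∀ b, ContDiffAt ℝ ((2 : ℕ) : WithTop ℕ∞) (fun Y => φ (WithLp.toLp 2 fun a =>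
      (logCoordC (star ((U₀ b : SU2) : Matrix (Fin 2) (Fin 2) ℂ) * Ũ (g Y) b) a).re)) 0 := fun b => by
    have h5 := (contDiff_reVec (n := ((2 : ℕ) : WithTop ℕ∞))).contDiffAt.comp 0 (hLb b)
    have h6 := (LinearMap.toContinuousLinearMap φ).contDiff (n := ((2 : ℕ) : WithTop ℕ∞)) |>.contDiffAt.comp 0 h5
    exact h6
  -- eventual smallness of `U₀⋆ · Ũ(0, ιA Y) − 1` and of `ιA Y`
  have hsmall : ∀ᶠ Y in 𝓝 (0 : GaugeSlice S T E3), ∀ b, ‖star ((U₀ b : SU2) : Matrix (Fin 2) (Fin 2) ℂ) * Ũ (g Y) b - 1‖ ≤ 1 / 3 := by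
    refine eventually_all.2 fun b => ?_
    have hc : ContinuousAt (fun Y => star ((U₀ b : SU2) : Matrix (Fin 2) (Fin 2) ℂ) * Ũ (g Y) b) 0 := (hMb b).continuousAt
    have ht : Tendsto (fun Y => ‖star ((U₀ b : SU2) : Matrix (Fin 2) (Fin 2) ℂ) * Ũ (g Y) b - 1‖) (𝓝 0) (𝓝 0) := by
      have h := ((hc.sub (continuousAt_const : ContinuousAt (fun _ : GaugeSlice S T E3 => (1 : Matrix (Fin 2) (Fin 2) ℂ)) 0)).norm).tendsto
      simpa only [Pi.sub_apply, hA0 b, sub_self, norm_zero] using h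
    exact ht.eventually (Iic_mem_nhds (by norm_num : (0 : ℝ) < 1 / 3))
  have hnormR : ∀ᶠ Y in 𝓝 (0 : GaugeSlice S T E3), ‖ιA S T Y‖ < R := by
    filter_upwards [Metric.ball_mem_nhds (0 : GaugeSlice S T E3) hR] with Y hY
    rw [mem_ball_zero_iff] at hY
    exact lt_of_le_of_lt ((pi_norm_le_iff_of_nonneg (norm_nonneg Y)).2 fun b => norm_ιA_apply_le Y b) hY
  subst hXf
  refine ⟨?_, ?_, ?_⟩
  · -- `Xf 0 = 0`
    funext b
    show φ _ = 0
    have hz : (WithLp.toLp 2 fun a => (logCoordC (star ((U₀ b : SU2) : Matrix (Fin 2) (Fin 2) ℂ) *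
        Ũ (cplxVec (0 : VecField P k E3), cplxVec (ιA S T 0)) b) a).re : EuclideanSpace ℝ (Fin 3)) = 0 := by
      have h1 : star ((U₀ b : SU2) : Matrix (Fin 2) (Fin 2) ℂ) * Ũ (cplxVec (0 : VecField P k E3), cplxVec (ιA S T 0)) b = 1 := by
        rw [map_zero, hU₀eq b]
        exact Matrix.mem_unitaryGroup_iff'.1 (U₀ b).prop.1
      rw [h1, logCoordC_one]
      ext a
      simp
    rw [hz, map_zero]
  · -- `C²` at `0`
    have h := contDiffAt_pi.2 fun b => hXb b
    exact_mod_cast h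
  · -- the family of minimisers near `0`
    filter_upwards [hsmall, hnormR] with Y hsY hYR
    obtain ⟨U', hU'eq, hU'min⟩ := hreal 0 (ιA S T Y) h0R hYR
    rw [expMul_zero] at hU'min
    have hchart : expChart U₀ (fun b => φ (WithLp.toLp 2 fun a =>
        (logCoordC (star ((U₀ b : SU2) : Matrix (Fin 2) (Fin 2) ℂ) * Ũ (cplxVec (0 : VecField P k E3), cplxVec (ιA S T Y)) b) a).re)) = U' := by
      funext b
      apply Subtype.ext
      rw [coe_expChart, hU'eq b]
      have hA : ‖star ((U₀ b : SU2) : Matrix (Fin 2) (Fin 2) ℂ) * ((U' b : SU2) : Matrix (Fin 2) (Fin 2) ℂ) - 1‖ ≤ 1 / 3 := by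
        have h := hsY b
        rwa [show g Y = (cplxVec (0 : VecField P k E3), cplxVec (ιA S T Y)) from rfl, hU'eq b] at h
      exact coe_mul_exp_logChart_eq φ hφ (U₀ b) (U' b) hA
    rw [hchart]
    exact hU'min


end Literature.MathematicalPhysics.QuantumFieldTheory.Balaban1983to89.B15Prop1RealChartFamilyExplicitB

end
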